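import Summits.CriticalPhenomena.PercolationContinuityZ3.Theorems.Transplant.SkelNeg1ChoiceOW
import Summits.CriticalPhenomena.PercolationContinuityZ3.Theorems.Transplant.SkelNegBChoiceAllS
import Summits.CriticalPhenomena.PercolationContinuityZ3.Theorems.Transplant.SkelRootChainW
import HarnessLib

/-!
# N1 (the `{±1}` node), (R) column (R7 glue): **`RootHoldsNOWFn` OF THE S1 CHOICE FUNCTION FROM THE PER-DIRECTION ROOT RESIDUES** —
# `PlanarSkeletonNeg.rootHoldsNOWFn_negChoiceAllOS_of`: if at every `(κ, G, Φ, t, p, hC, O, q)` with `(choiceAtOS …).AtQO O q` (one vertex type, `0 < p < 1`) and every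
# direction `du` the per-direction residue `Skel.RootOblTWAt G ((choiceAtOS …).scheme O q) Φ.Δ κ.δr du` holds (the conclusions of `NegB.rootOblTWAt_negBS2_x/_y`,
# SkelPhiRootNegBX2/Y2), then `RootHoldsNOWFn (negChoiceAllOS gv fv Pv Sv)` — the (R) hypothesis of `samePDropOfSkeletonNeg₁_of_choiceFnNOW`. Pure glue
# (`negChoiceAllOS_eq` + `Skel.rootOblTW_iff`); the x/y split by `du.1` is left to the instantiation.

builds on p205010 (kernel theorem, internal audit signed; external expert review pending) — nothing in this file uses p205010; NOTHING is claimed about the open node.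
Lane `prim-bschramm`, seat `prim-bschramm-p3` (gen 9; design owner + (R) owner); helper file (`--supports stmt-CriticalPhenomena-4575 --as helper`).
[cite: KozmaNitzan2024, §4 p. 28] [folklore]
-/

noncomputable section

open scoped Classical

namespace Summit.CriticalPhenomena.PercolationContinuityZ3.Theorems.Transplant

namespace PlanarSkeletonNeg

open SkelConc (Consts)
open Skelφ.StepI (OutO)
open Literature.Probability.Percolation

/-- **`RootHoldsNOWFn (negChoiceAllOS …)` from the per-direction root residues at `AtQO`.** [folklore] -/
theorem rootHoldsNOWFn_negChoiceAllOS_of (gv fv : Neg.FSlot) (Pv : NegB.PSlot) (Sv : NegB.SSlot)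
    (h : ∀ (κ : Consts) {V : Type} [DecidableEq V] [Countable V] (G : SimpleGraph V) [G.LocallyFinite] (Φ : PlanarSkeletonNeg G) (t : V) (p : unitInterval)
      (hC : Φ.CylSubcritical p) (O : OutO V) (q : unitInterval), (NegB.choiceAtOS κ Φ t p gv fv Sv hC Pv).AtQO O q → Φ.types = {t} → 0 < (p : ℝ) → (p : ℝ) < 1 →
      ∀ du : MDir, Skel.RootOblTWAt G ((NegB.choiceAtOS κ Φ t p gv fv Sv hC Pv).scheme O q) Φ.Δ κ.δr du) :
    RootHoldsNOWFn (negChoiceAllOS gv fv Pv Sv) := by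
  intro κ V _ _ G _ Φ hg t ht h1 p hp0 hp1 hC O q hAt
  rw [negChoiceAllOS_eq] at hAt ⊢
  exact Skel.rootOblTW_iff.2 fun du => h κ G Φ t p hC O q hAt h1 hp0 hp1 du

/-- The same with the two direction families separated (`du.1 = 0`: x-family, `du.1 = 1`: y′-family). [folklore] -/
theorem rootHoldsNOWFn_negChoiceAllOS_of_xy (gv fv : Neg.FSlot) (Pv : NegB.PSlot) (Sv : NegB.SSlot)
    (hx : ∀ (κ : Consts) {V : Type} [DecidableEq V] [Countable V] (G : SimpleGraph V) [G.LocallyFinite] (Φ : PlanarSkeletonNeg G) (t : V) (p : unitInterval)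
      (hC : Φ.CylSubcritical p) (O : OutO V) (q : unitInterval), (NegB.choiceAtOS κ Φ t p gv fv Sv hC Pv).AtQO O q → Φ.types = {t} → 0 < (p : ℝ) → (p : ℝ) < 1 →
      ∀ du : MDir, du.1 = 0 → Skel.RootOblTWAt G ((NegB.choiceAtOS κ Φ t p gv fv Sv hC Pv).scheme O q) Φ.Δ κ.δr du)
    (hy : ∀ (κ : Consts) {V : Type} [DecidableEq V] [Countable V] (G : SimpleGraph V) [G.LocallyFinite] (Φ : PlanarSkeletonNeg G) (t : V) (p : unitInterval)
      (hC : Φ.CylSubcritical p) (O : OutO V) (q : unitInterval), (NegB.choiceAtOS κ Φ t p gv fv Sv hC Pv).AtQO O q → Φ.types = {t} → 0 < (p : ℝ) → (p : ℝ) < 1 →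
      ∀ du : MDir, du.1 = 1 → Skel.RootOblTWAt G ((NegB.choiceAtOS κ Φ t p gv fv Sv hC Pv).scheme O q) Φ.Δ κ.δr du) :
    RootHoldsNOWFn (negChoiceAllOS gv fv Pv Sv) := by
  refine rootHoldsNOWFn_negChoiceAllOS_of gv fv Pv Sv fun κ V _ _ G _ Φ t p hC O q hAt h1 hp0 hp1 du => ?_
  have hd : du.1 = 0 ∨ du.1 = 1 := by rcases du with ⟨i, b⟩; fin_cases i <;> simp
  rcases hd with hd | hd
  · exact hx κ G Φ t p hC O q hAt h1 hp0 hp1 du hd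
  · exact hy κ G Φ t p hC O q hAt h1 hp0 hp1 du hd

end PlanarSkeletonNeg

end Summit.CriticalPhenomena.PercolationContinuityZ3.Theorems.Transplant

end
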